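import Literature.NumberTheory.GaloisRepresentations.PstWeilDeligneFontaineLaffaille
import HarnessLib

/-!
# Crux `AdjointLiftingGL3` (stmt-Langlands-16779), line `birth`: stub `stub_localInertialType`,
# part 1 — exponent arithmetic and the normal form of the Fontaine–Laffaille blocks

First helper file of stub `stub_localInertialType` (CORE-A of the Fontaine–Laffaille stub S2a of
skeleton v6 of `Cruxes/AdjointLiftingGL3/Lines/birth.lean`).  The stub compares, on the inertia group
`I_K` of a `p`-adic field `K` with `q = #𝓀[K]`, the semisimplified reduction of `T = χ ⊗ ad⁰ V` —
three characters `{x, x·α/β, x·β/α}` (`x = χ|_{I_K}`, `(α, β)` the diagonal characters of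
`V|_{I_K}`) — with the multiset of tame inertia characters of a list of Fontaine–Laffaille blocks of
digit multiset `{0, 1, 2}` (`flBlockCharacters`, `flBlockDigits` of the accepted clause (F13), file
`Literature/NumberTheory/GaloisRepresentations/PstWeilDeligneFontaineLaffaille.lean`).  This file
carries the part of the argument which is pure arithmetic:

* §1 integer lemmas: the congruences modulo `N = q² − 1 = (q + 1)(q − 1)` extracted from a
  three-element multiset identity `{ζ^E₁, ζ^E₂, ζ^E₃} = {ζ^F₁, ζ^F₂, ζ^F₃}` for a primitive `N`-th
  root of unity `ζ` (`trio`), and their resolution in the three block patterns (`arith_R111`: three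
  level-one blocks; `arith_R21`: a level-two and a level-one block; `arith_level3`: a level-three
  block is impossible) and for the two levels of `V` (`levelOne_dvd`, `levelTwo_dvd`);
* §2 the normal form of the digits and characters of a list of blocks of levels `≤ 3`
  (`flBlocks_decomp`: level-one digits `L₁`, ordered digit pairs `L₂` of level-two blocks, digit
  functions `L₃` of level-three blocks).

References: Fontaine–Laffaille 1982 Thm. 5.3 (iii); Gee–Herzig–Liu–Savitt 2017 Prop. 2.3.1;
Serre 1987 §2.1–2.4.
-/

set_option linter.dupNamespace false -- `Summit.Langlands.Langlands` is the mandated namespace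

noncomputable section

namespace Summit.Langlands.Langlands.Cruxes.AdjointLiftingGL3.Birth

open scoped MatrixGroups
open Field ValuativeRel
open Literature.NumberTheory.GaloisRepresentations
open Literature.NumberTheory.GaloisRepresentations.IsNonarchimedeanLocalField

/-! ## §1. Integer arithmetic modulo `q² − 1` -/

section Arith

/-- If `n ∣ a`, `a = n t + r` and `|r| < n` then `r = 0`. [folklore] -/
theorem eq_zero_of_dvd_of_eq_add {n a t r : ℤ} (h : n ∣ a) (he : a = n * t + r) (hr : |r| < n) :
    r = 0 := by
  refine Int.eq_zero_of_abs_lt_dvd ?_ hr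
  have := dvd_sub h (dvd_mul_right n t)
  rwa [he, add_sub_cancel_left] at this

/-- Linear combinations of multiples are multiples (with the target given up to `ring`).
[folklore] -/
theorem dvd_comb {N A B C : ℤ} (hA : N ∣ A) (hB : N ∣ B) (m n : ℤ) (hC : C = m * A + n * B) :
    N ∣ C := by
  rw [hC]; exact dvd_add (dvd_mul_of_dvd_right hA m) (dvd_mul_of_dvd_right hB n)

/-- **Congruences from a three-element multiset identity of powers of a primitive root.**  If
`{a₁, a₂, a₃} = {b₁, b₂, b₃}` with `a_i = ζ^{E_i}`, `b_j = ζ^{F_j}` for a primitive `N`-th root of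
unity `ζ` of a commutative group, then modulo `N`: `F₁` is one of the `E_i`, the sums agree, and
`E₁`, `E₂` are among the `F_j`. [folklore] -/
theorem trio {G : Type*} [CommGroup G] {ζ : G} {N : ℕ} (hζ : IsPrimitiveRoot ζ N)
    {a₁ a₂ a₃ b₁ b₂ b₃ : G} {E₁ E₂ E₃ F₁ F₂ F₃ : ℤ}
    (h : ({a₁, a₂, a₃} : Multiset G) = {b₁, b₂, b₃})
    (ha₁ : a₁ = ζ ^ E₁) (ha₂ : a₂ = ζ ^ E₂) (ha₃ : a₃ = ζ ^ E₃)
    (hb₁ : b₁ = ζ ^ F₁) (hb₂ : b₂ = ζ ^ F₂) (hb₃ : b₃ = ζ ^ F₃) :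
    ((N : ℤ) ∣ F₁ - E₁ ∨ (N : ℤ) ∣ F₁ - E₂ ∨ (N : ℤ) ∣ F₁ - E₃) ∧
      ((N : ℤ) ∣ (E₁ + E₂ + E₃) - (F₁ + F₂ + F₃)) ∧
      ((N : ℤ) ∣ E₁ - F₁ ∨ (N : ℤ) ∣ E₁ - F₂ ∨ (N : ℤ) ∣ E₁ - F₃) ∧
      ((N : ℤ) ∣ E₂ - F₁ ∨ (N : ℤ) ∣ E₂ - F₂ ∨ (N : ℤ) ∣ E₂ - F₃) := by
  subst ha₁ ha₂ ha₃ hb₁ hb₂ hb₃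
  have key : ∀ {A B : ℤ}, ζ ^ A = ζ ^ B → (N : ℤ) ∣ A - B := fun {A B} hAB =>
    (hζ.zpow_eq_one_iff_dvd _).mp (by rw [zpow_sub, hAB, mul_inv_cancel])
  have hF₁ : ζ ^ F₁ ∈ ({ζ ^ E₁, ζ ^ E₂, ζ ^ E₃} : Multiset G) := by
    rw [h]; exact Multiset.mem_cons_self _ _
  have hE₁ : ζ ^ E₁ ∈ ({ζ ^ F₁, ζ ^ F₂, ζ ^ F₃} : Multiset G) := by
    rw [← h]; exact Multiset.mem_cons_self _ _
  have hE₂ : ζ ^ E₂ ∈ ({ζ ^ F₁, ζ ^ F₂, ζ ^ F₃} : Multiset G) := by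
    rw [← h]; exact Multiset.mem_cons_of_mem (Multiset.mem_cons_self _ _)
  have hprod := congrArg Multiset.prod h
  simp only [Multiset.insert_eq_cons, Multiset.prod_cons, Multiset.prod_singleton, ← zpow_add]
    at hprod
  simp only [Multiset.insert_eq_cons, Multiset.mem_cons, Multiset.mem_singleton] at hF₁ hE₁ hE₂
  refine ⟨hF₁.imp key (Or.imp key key), ?_, hE₁.imp key (Or.imp key key),
    hE₂.imp key (Or.imp key key)⟩
  have := key hprod
  rwa [← add_assoc, ← add_assoc] at this

/-- `w = ζ^n` gives `w^e = ζ^{n e}`. [folklore] -/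
theorem zpow_of_eq_pow {G : Type*} [CommGroup G] {ζ w : G} {n : ℕ} (hw : w = ζ ^ n) (e : ℤ) {E : ℤ}
    (hE : E = (n : ℤ) * e) : w ^ e = ζ ^ E := by
  subst hE; rw [hw, ← zpow_natCast, ← zpow_mul]

/-- **Three level-one blocks** (digits `0, 1, 2`, values `w^0, w^{-1}, w^{-2}` at `σ₂`,
`w = ζ^{q+1}`) against `{x, x l, x l⁻¹}` with `x = w^c`, `l = ζ^L`: then `(q − 1) ∣ c + 1` and
`L ≡ ±(q + 1)` (or, vacuously here, `±(q − 1)`) modulo `N = q² − 1`. [cite: Serre1987, §2.2–2.4] -/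
theorem arith_R111 {N q c L E₁ E₂ E₃ F₁ F₂ F₃ : ℤ} (hq : 11 ≤ q) (hN : N = (q + 1) * (q - 1))
    (hE₁ : E₁ = (q + 1) * (-0)) (hE₂ : E₂ = (q + 1) * (-1)) (hE₃ : E₃ = (q + 1) * (-2))
    (hF₁ : F₁ = (q + 1) * c) (hF₂ : F₂ = (q + 1) * c + L) (hF₃ : F₃ = (q + 1) * c + -L)
    (h : (N ∣ F₁ - E₁ ∨ N ∣ F₁ - E₂ ∨ N ∣ F₁ - E₃) ∧ (N ∣ (E₁ + E₂ + E₃) - (F₁ + F₂ + F₃)) ∧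
      (N ∣ E₁ - F₁ ∨ N ∣ E₁ - F₂ ∨ N ∣ E₁ - F₃) ∧ (N ∣ E₂ - F₁ ∨ N ∣ E₂ - F₂ ∨ N ∣ E₂ - F₃)) :
    (q - 1 ∣ c + 1) ∧ (N ∣ L - (q + 1) ∨ N ∣ L + (q + 1) ∨ N ∣ L - (q - 1) ∨ N ∣ L + (q - 1)) := by
  subst hN hE₁ hE₂ hE₃ hF₁ hF₂ hF₃
  obtain ⟨h1, h2, h3, -⟩ := h
  have hq1 : (q + 1 : ℤ) ≠ 0 := by omega
  have red : ∀ {m : ℤ}, (q + 1) * (q - 1) ∣ (q + 1) * m → q - 1 ∣ m := fun {m} hm =>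
    (mul_dvd_mul_iff_left hq1).mp hm
  -- the product: `(q - 1) ∣ 3 (c + 1)`
  have h3c : q - 1 ∣ 3 * (c + 1) := red (dvd_comb h2 h2 (-1) 0 (by ring))
  -- membership of `x`: `(q - 1) ∣ c + 1`
  have hc1 : q - 1 ∣ c + 1 := by
    rcases h1 with h1 | h1 | h1
    · have hc : q - 1 ∣ c := red (dvd_comb h1 h1 1 0 (by ring))
      have h3 : q - 1 ∣ 3 := dvd_comb h3c hc 1 (-3) (by ring)
      have := Int.le_of_dvd (by norm_num) h3
      omega
    · exact red (dvd_comb h1 h1 1 0 (by ring))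
    · have hc : q - 1 ∣ c + 2 := red (dvd_comb h1 h1 1 0 (by ring))
      have h3 : q - 1 ∣ 3 := dvd_comb hc h3c 3 (-1) (by ring)
      have := Int.le_of_dvd (by norm_num) h3
      omega
  refine ⟨hc1, ?_⟩
  have hN1 : (q + 1) * (q - 1) ∣ (q + 1) * (c + 1) := mul_dvd_mul_left _ hc1
  rcases h3 with h3 | h3 | h3
  · have hc : q - 1 ∣ c := red (dvd_comb h3 h3 (-1) 0 (by ring))
    have h1' : q - 1 ∣ 1 := dvd_comb hc1 hc 1 (-1) (by ring)
    have := Int.le_of_dvd (by norm_num) h1'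
    omega
  · exact Or.inl (dvd_comb h3 hN1 (-1) (-1) (by ring))
  · exact Or.inr (Or.inl (dvd_comb h3 hN1 1 1 (by ring)))

/-- **A level-two block `(d₀, d₁)` and a level-one block `d₂`** (`{d₀, d₁, d₂} = {0, 1, 2}`, values
`w^{-d₂}, ζ^{-(d₀ + q d₁)}, ζ^{-(d₁ + q d₀)}` at `σ₂`) against `{x, x l, x l⁻¹}` with `x = w^c`,
`l = ζ^L`: then `d₂ = 1`, `(q − 1) ∣ c + 1` and `L ≡ ±(q − 1)` (or, vacuously here, `±(q + 1)`)
modulo `N = q² − 1`. [cite: Serre1987, §2.2–2.4] -/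
theorem arith_R21 {N q c L d₀ d₁ d₂ E₁ E₂ E₃ F₁ F₂ F₃ : ℤ} (hq : 11 ≤ q)
    (hN : N = (q + 1) * (q - 1)) (hd : ({d₂, d₀, d₁} : Multiset ℤ) = {0, 1, 2})
    (hE₁ : E₁ = (q + 1) * (-d₂)) (hE₂ : E₂ = -(d₀ + d₁ * q)) (hE₃ : E₃ = -(d₁ + d₀ * q))
    (hF₁ : F₁ = (q + 1) * c) (hF₂ : F₂ = (q + 1) * c + L) (hF₃ : F₃ = (q + 1) * c + -L)
    (h : (N ∣ F₁ - E₁ ∨ N ∣ F₁ - E₂ ∨ N ∣ F₁ - E₃) ∧ (N ∣ (E₁ + E₂ + E₃) - (F₁ + F₂ + F₃)) ∧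
      (N ∣ E₁ - F₁ ∨ N ∣ E₁ - F₂ ∨ N ∣ E₁ - F₃) ∧ (N ∣ E₂ - F₁ ∨ N ∣ E₂ - F₂ ∨ N ∣ E₂ - F₃)) :
    (q - 1 ∣ c + 1) ∧ (N ∣ L - (q + 1) ∨ N ∣ L + (q + 1) ∨ N ∣ L - (q - 1) ∨ N ∣ L + (q - 1)) := by
  subst hN hE₁ hE₂ hE₃ hF₁ hF₂ hF₃
  -- the digits
  have hnd : Multiset.Nodup ({d₂, d₀, d₁} : Multiset ℤ) := by rw [hd]; decide
  simp only [Multiset.insert_eq_cons, Multiset.nodup_cons, Multiset.mem_cons,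
    Multiset.mem_singleton, not_or, Multiset.nodup_singleton] at hnd
  have hm₂ : d₂ ∈ ({d₂, d₀, d₁} : Multiset ℤ) := Multiset.mem_cons_self _ _
  have hm₀ : d₀ ∈ ({d₂, d₀, d₁} : Multiset ℤ) := Multiset.mem_cons_of_mem (Multiset.mem_cons_self _ _)
  have hm₁ : d₁ ∈ ({d₂, d₀, d₁} : Multiset ℤ) :=
    Multiset.mem_cons_of_mem (Multiset.mem_cons_of_mem (Multiset.mem_singleton_self _))
  rw [hd] at hm₂ hm₀ hm₁
  simp only [Multiset.insert_eq_cons, Multiset.mem_cons, Multiset.mem_singleton] at hm₂ hm₀ hm₁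
  obtain ⟨h1, h2, h3, h4⟩ := h
  have hq1 : (q + 1 : ℤ) ≠ 0 := by omega
  have red : ∀ {m : ℤ}, (q + 1) * (q - 1) ∣ (q + 1) * m → q - 1 ∣ m := fun {m} hm =>
    (mul_dvd_mul_iff_left hq1).mp hm
  have hplus : ∀ {m : ℤ}, (q + 1) * (q - 1) ∣ m → q + 1 ∣ m := fun {m} hm =>
    (dvd_mul_right _ _).trans hm
  -- a level-two value is not a power of `w`: `x` is the level-one value
  have hne : ∀ {m : ℤ}, ¬ (q + 1) * (q - 1) ∣ (q + 1) * m + (d₀ - d₁) := by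
    intro m hm
    have := eq_zero_of_dvd_of_eq_add (hplus hm) rfl (abs_lt.mpr ⟨by omega, by omega⟩)
    omega
  have hne' : ∀ {m : ℤ}, ¬ (q + 1) * (q - 1) ∣ (q + 1) * m + (d₁ - d₀) := by
    intro m hm
    have := eq_zero_of_dvd_of_eq_add (hplus hm) rfl (abs_lt.mpr ⟨by omega, by omega⟩)
    omega
  have hc2 : q - 1 ∣ c + d₂ := by
    rcases h1 with h1 | h1 | h1
    · exact red (dvd_comb h1 h1 1 0 (by ring))
    · exact absurd (dvd_comb h1 h1 1 0 (by ring) : _ ∣ (q + 1) * (c + d₁) + (d₀ - d₁)) hne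
    · exact absurd (dvd_comb h1 h1 1 0 (by ring) : _ ∣ (q + 1) * (c + d₀) + (d₁ - d₀)) hne'
  -- the product: `(q - 1) ∣ 3 (c + 1)`, hence `d₂ = 1`
  have hsum : d₀ + d₁ + d₂ = 3 := by omega
  have h3c : q - 1 ∣ 3 * (c + 1) := by
    refine red (dvd_comb h2 h2 (-1) 0 ?_)
    linear_combination (-(q + 1)) * hsum
  have hd₂ : d₂ = 1 := by
    have h3 : q - 1 ∣ 3 * (1 - d₂) := dvd_comb h3c hc2 1 (-3) (by ring)
    have := eq_zero_of_dvd_of_eq_add h3 (t := 0) (r := 3 * (1 - d₂)) (by ring)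
      (abs_lt.mpr ⟨by omega, by omega⟩)
    omega
  subst hd₂
  refine ⟨by simpa using hc2, ?_⟩
  have hN1 : (q + 1) * (q - 1) ∣ (q + 1) * (c + 1) := mul_dvd_mul_left _ (by simpa using hc2)
  have h02 : (d₀ = 0 ∧ d₁ = 2) ∨ (d₀ = 2 ∧ d₁ = 0) := by omega
  rcases h4 with h4 | h4 | h4
  · exact absurd (dvd_comb h4 h4 (-1) 0 (by ring) : _ ∣ (q + 1) * (c + d₁) + (d₀ - d₁)) hne
  · rcases h02 with ⟨rfl, rfl⟩ | ⟨rfl, rfl⟩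
    · exact Or.inr (Or.inr (Or.inr (dvd_comb h4 hN1 (-1) (-1) (by ring))))
    · exact Or.inr (Or.inr (Or.inl (dvd_comb h4 hN1 (-1) (-1) (by ring))))
  · rcases h02 with ⟨rfl, rfl⟩ | ⟨rfl, rfl⟩
    · exact Or.inr (Or.inr (Or.inl (dvd_comb h4 hN1 1 1 (by ring))))
    · exact Or.inr (Or.inr (Or.inr (dvd_comb h4 hN1 1 1 (by ring))))

/-- **A level-three block is impossible**: if `(q³ − 1) ∣ (q² + q + 1) c + (f₀ + f₁ q + f₂ q²)` for
pairwise distinct digits `f_i ∈ {0, 1, 2}` (the exponent of a character of a level-three block of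
digit multiset `{0, 1, 2}` against `x = ω^c = ψ₃^{(q²+q+1)c}`), contradiction: modulo `q² + q + 1`
the exponent is `(f₀ − f₂) + (f₁ − f₂) q`, of absolute value `< q² + q + 1`, hence zero, forcing
`f₁ = f₂`. [cite: FontaineLaffaille1982, Thm. 5.3 (iii)] -/
theorem arith_level3 {q c e f₀ f₁ f₂ : ℤ} (hq : 11 ≤ q) (h₀ : f₀ = 0 ∨ f₀ = 1 ∨ f₀ = 2)
    (h₁ : f₁ = 0 ∨ f₁ = 1 ∨ f₁ = 2) (h₂ : f₂ = 0 ∨ f₂ = 1 ∨ f₂ = 2) (h01 : f₀ ≠ f₁)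
    (h02 : f₀ ≠ f₂) (h12 : f₁ ≠ f₂) (he : e = f₀ + f₁ * q + f₂ * q ^ 2)
    (h : q ^ 3 - 1 ∣ (q ^ 2 + q + 1) * c + e) : False := by
  subst he
  have h' : q ^ 2 + q + 1 ∣ (q ^ 2 + q + 1) * c + (f₀ + f₁ * q + f₂ * q ^ 2) :=
    (Dvd.intro (q - 1) (by ring)).trans h
  have hq2 : 2 * q + 3 ≤ q ^ 2 := by nlinarith
  have hr := eq_zero_of_dvd_of_eq_add h' (t := c + f₂) (r := (f₀ - f₂) + (f₁ - f₂) * q) (by ring)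
    (by
      rcases h₀ with rfl | rfl | rfl <;> rcases h₁ with rfl | rfl | rfl <;>
        rcases h₂ with rfl | rfl | rfl <;> exact abs_lt.mpr ⟨by linarith, by linarith⟩)
  rcases h₀ with rfl | rfl | rfl <;> rcases h₁ with rfl | rfl | rfl <;>
    rcases h₂ with rfl | rfl | rfl <;> first | exact h01 rfl | exact h12 rfl | linarith

/-- **Level-one `V`** (`l = w^m = ζ^{(q+1)m}`): the congruences `L ≡ ±(q + 1), ±(q − 1)` modulo
`(q + 1)(q − 1)` for `L = (q + 1) m` mean `m ≡ 1` or `m ≡ −1` modulo `q − 1` (the other two are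
impossible modulo `q + 1`). [cite: Serre1987, §2.3–2.4] -/
theorem levelOne_dvd {q m : ℤ} (hq : 11 ≤ q)
    (h : (q + 1) * (q - 1) ∣ (q + 1) * m - (q + 1) ∨ (q + 1) * (q - 1) ∣ (q + 1) * m + (q + 1) ∨
      (q + 1) * (q - 1) ∣ (q + 1) * m - (q - 1) ∨ (q + 1) * (q - 1) ∣ (q + 1) * m + (q - 1)) :
    (q - 1 ∣ m - 1) ∨ (q - 1 ∣ m + 1) := by
  have hq1 : (q + 1 : ℤ) ≠ 0 := by omega
  rcases h with h | h | h | h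
  · exact Or.inl ((mul_dvd_mul_iff_left hq1).mp (dvd_comb h h 1 0 (by ring)))
  · exact Or.inr ((mul_dvd_mul_iff_left hq1).mp (dvd_comb h h 1 0 (by ring)))
  · have := eq_zero_of_dvd_of_eq_add ((dvd_mul_right _ _).trans h) (t := m - 1) (r := 2) (by ring)
      (abs_lt.mpr ⟨by omega, by omega⟩)
    omega
  · have := eq_zero_of_dvd_of_eq_add ((dvd_mul_right _ _).trans h) (t := m + 1) (r := -2)
      (by ring) (abs_lt.mpr ⟨by omega, by omega⟩)
    omega

/-- **Level-two `V`** (`l = ψ₂^n / ψ₂^{qn} = ζ^{n(1−q)}` at `σ₂`): the congruences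
`L ≡ ±(q + 1), ±(q − 1)` modulo `(q + 1)(q − 1)` for `L = n (1 − q)` mean `(q + 1) ∣ n − 1` or
`(q + 1) ∣ n + 1` (the other two are impossible modulo `q − 1`). [cite: Serre1987, §2.2] -/
theorem levelTwo_dvd {q n : ℤ} (hq : 11 ≤ q)
    (h : (q + 1) * (q - 1) ∣ n * (1 - q) - (q + 1) ∨ (q + 1) * (q - 1) ∣ n * (1 - q) + (q + 1) ∨
      (q + 1) * (q - 1) ∣ n * (1 - q) - (q - 1) ∨ (q + 1) * (q - 1) ∣ n * (1 - q) + (q - 1)) :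
    (q + 1 ∣ n - 1) ∨ (q + 1 ∣ n + 1) := by
  have hq1 : (q - 1 : ℤ) ≠ 0 := by omega
  have hcomm : (q + 1) * (q - 1) = (q - 1) * (q + 1) := mul_comm _ _
  rw [hcomm] at h
  rcases h with h | h | h | h
  · have := eq_zero_of_dvd_of_eq_add ((dvd_mul_right _ _).trans h) (t := -n - 1) (r := -2)
      (by ring) (abs_lt.mpr ⟨by omega, by omega⟩)
    omega
  · have := eq_zero_of_dvd_of_eq_add ((dvd_mul_right _ _).trans h) (t := -n + 1) (r := 2)
      (by ring) (abs_lt.mpr ⟨by omega, by omega⟩)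
    omega
  · exact Or.inr ((mul_dvd_mul_iff_left hq1).mp (dvd_comb h h (-1) 0 (by ring)))
  · exact Or.inl ((mul_dvd_mul_iff_left hq1).mp (dvd_comb h h (-1) 0 (by ring)))

end Arith

/-! ## §2. Normal form of a list of Fontaine–Laffaille blocks of levels `≤ 3` -/

section Blocks

/-- `univ.val.map f = 0` over `Fin 0`. [folklore] -/
theorem univ_val_map_fin_zero {α : Type*} (f : Fin 0 → α) :
    (Finset.univ : Finset (Fin 0)).val.map f = 0 := by
  rw [Fin.univ_val_map]; rfl

/-- `univ.val.map f = {f 0}` over `Fin 1`. [folklore] -/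
theorem univ_val_map_fin_one {α : Type*} (f : Fin 1 → α) :
    (Finset.univ : Finset (Fin 1)).val.map f = {f 0} := by
  rw [Fin.univ_val_map]; rfl

/-- `univ.val.map f = {f 0, f 1}` over `Fin 2`. [folklore] -/
theorem univ_val_map_fin_two {α : Type*} (f : Fin 2 → α) :
    (Finset.univ : Finset (Fin 2)).val.map f = {f 0, f 1} := by
  rw [Fin.univ_val_map]; rfl

/-- `univ.val.map f = {f 0, f 1, f 2}` over `Fin 3`. [folklore] -/
theorem univ_val_map_fin_three {α : Type*} (f : Fin 3 → α) :
    (Finset.univ : Finset (Fin 3)).val.map f = {f 0, f 1, f 2} := by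
  rw [Fin.univ_val_map]; rfl

variable (K : Type) [Field K] [ValuativeRel K] [TopologicalSpace K] [IsNonarchimedeanLocalField K]
  {k : Type*} [Field k]

/-- `flBlockDigits` of a cons. [folklore] -/
theorem flBlockDigits_cons (b : Σ h : ℕ, Fin h → ℤ) (B : List (Σ h : ℕ, Fin h → ℤ)) :
    flBlockDigits (b :: B) = (Finset.univ : Finset (Fin b.1)).val.map b.2 + flBlockDigits B := rfl

/-- `flBlockCharacters` of a cons. [folklore] -/
theorem flBlockCharacters_cons (ι : absIntegers 𝒪[K] K ⧸ absMaximalIdeal K →+* k) (ϖ : 𝒪[K])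
    (hϖ : Irreducible ϖ) (b : Σ h : ℕ, Fin h → ℤ) (B : List (Σ h : ℕ, Fin h → ℤ)) :
    flBlockCharacters K ι ϖ hϖ (b :: B) =
      (Finset.univ : Finset (Fin b.1)).val.map (fun j =>
        (fundamentalCharacter K b.1 ι ϖ hϖ) ^
          (-(∑ m : Fin b.1, b.2 ⟨(j.val + m.val) % b.1, Nat.mod_lt _ (Fin.pos j)⟩ *
            ((residueFieldCard K : ℤ) ^ m.val)))) +
        flBlockCharacters K ι ϖ hϖ B := rfl

/-- The number of digits of a list of blocks is the sum of the levels. [folklore] -/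
theorem card_flBlockDigits (B : List (Σ h : ℕ, Fin h → ℤ)) :
    Multiset.card (flBlockDigits B) = (B.map fun b => b.1).sum := by
  induction B with
  | nil => rfl
  | cons b B ih =>
    rw [flBlockDigits_cons, Multiset.card_add, ih, Multiset.card_map, List.map_cons, List.sum_cons,
      Finset.card_val, Finset.card_univ, Fintype.card_fin]

/-- **Normal form of the digits and characters of a list of blocks of levels `≤ 3`**: the level-one
digits `L₁`, the ordered digit pairs `L₂` of the level-two blocks and the digit functions `L₃` of the
level-three blocks, with `flBlockDigits` and `flBlockCharacters` the corresponding sums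
(level-one block `d ↦ ψ₁^{-d}`; level-two block `(d₀, d₁) ↦ ψ₂^{-(d₀ + d₁ q)}, ψ₂^{-(d₁ + d₀ q)}`;
level-zero blocks contribute nothing). [cite: FontaineLaffaille1982, Thm. 5.3 (iii)] -/
theorem flBlocks_decomp (ι : absIntegers 𝒪[K] K ⧸ absMaximalIdeal K →+* k) (ϖ : 𝒪[K])
    (hϖ : Irreducible ϖ) (B : List (Σ h : ℕ, Fin h → ℤ)) (hB : ∀ b ∈ B, b.1 ≤ 3) :
    ∃ (L₁ : Multiset ℤ) (L₂ : Multiset (ℤ × ℤ)) (L₃ : Multiset (Fin 3 → ℤ)),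
      flBlockDigits B = L₁ + L₂.bind (fun e => {e.1, e.2}) +
        L₃.bind (fun d => (Finset.univ : Finset (Fin 3)).val.map d) ∧
      flBlockCharacters K ι ϖ hϖ B =
        L₁.map (fun e => (fundamentalCharacter K 1 ι ϖ hϖ) ^ (-e)) +
        L₂.bind (fun e => {(fundamentalCharacter K 2 ι ϖ hϖ) ^ (-(e.1 + e.2 * (residueFieldCard K : ℤ))),
          (fundamentalCharacter K 2 ι ϖ hϖ) ^ (-(e.2 + e.1 * (residueFieldCard K : ℤ)))}) +
        L₃.bind (fun d => (Finset.univ : Finset (Fin 3)).val.map (fun j =>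
          (fundamentalCharacter K 3 ι ϖ hϖ) ^
            (-(∑ m : Fin 3, d ⟨(j.val + m.val) % 3, Nat.mod_lt _ (Fin.pos j)⟩ *
              ((residueFieldCard K : ℤ) ^ m.val))))) := by
  induction B with
  | nil => exact ⟨0, 0, 0, by simp [flBlockDigits], by simp [flBlockCharacters]⟩
  | cons b B ih =>
    obtain ⟨L₁, L₂, L₃, hD, hC⟩ := ih fun b hb => hB b (List.mem_cons_of_mem _ hb)
    have hb : b.1 ≤ 3 := hB b List.mem_cons_self
    obtain ⟨h, d⟩ := b
    rw [flBlockDigits_cons, flBlockCharacters_cons, hD, hC]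
    dsimp only at hb ⊢
    interval_cases h
    · exact ⟨L₁, L₂, L₃, by rw [univ_val_map_fin_zero, zero_add],
        by rw [univ_val_map_fin_zero, zero_add]⟩
    · refine ⟨d 0 ::ₘ L₁, L₂, L₃, ?_, ?_⟩
      · rw [univ_val_map_fin_one, Multiset.singleton_add, Multiset.cons_add, Multiset.cons_add]
      · rw [univ_val_map_fin_one, Multiset.singleton_add, Multiset.map_cons, Multiset.cons_add,
          Multiset.cons_add]
        congr 2
        rw [Fin.sum_univ_one]
        have h0 : ∀ i : Fin 1, d i = d 0 := fun i => by rw [Subsingleton.elim i 0]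
        simp [h0]
    · refine ⟨L₁, (d 0, d 1) ::ₘ L₂, L₃, ?_, ?_⟩
      · rw [univ_val_map_fin_two, Multiset.cons_bind]
        abel
      · rw [univ_val_map_fin_two, Multiset.cons_bind]
        have e : ({fundamentalCharacter K 2 ι ϖ hϖ ^
              (-∑ m : Fin 2, d ⟨((0 : Fin 2).val + m.val) % 2, Nat.mod_lt _ (Fin.pos 0)⟩ *
                (residueFieldCard K : ℤ) ^ m.val),
            fundamentalCharacter K 2 ι ϖ hϖ ^
              (-∑ m : Fin 2, d ⟨((1 : Fin 2).val + m.val) % 2, Nat.mod_lt _ (Fin.pos 1)⟩ *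
                (residueFieldCard K : ℤ) ^ m.val)} : Multiset _) =
            {fundamentalCharacter K 2 ι ϖ hϖ ^ (-(d 0 + d 1 * (residueFieldCard K : ℤ))),
              fundamentalCharacter K 2 ι ϖ hϖ ^ (-(d 1 + d 0 * (residueFieldCard K : ℤ)))} := by
          simp [Fin.sum_univ_two]
        rw [e]
        abel
    · refine ⟨L₁, L₂, d ::ₘ L₃, ?_, ?_⟩
      · rw [Multiset.cons_bind]
        abel
      · rw [Multiset.cons_bind]
        abel

end Blocks

end Summit.Langlands.Langlands.Cruxes.AdjointLiftingGL3.Birth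

end
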